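import Summits.QuantumFields.BalabanUV.Beta.CompositeVertexKernelRec

/-!
# `BalabanUV.Beta.CompositeVertexKernelCongr` — row D1 ∕ (C1), F3 supplement: CONGRUENCE of the composite kernels in the bricks

WHAT.  The depth-`n` composite kernels of `CompositeVertexKernelRec` read the bricks `ℓ m`, `𝓋 m` at levels `m < n` ONLY:
`compLinKer_congr`, `compVHKer_congr`, `compVhS_congr`.  WHY (located): leaf-02 g29 W-7 (journal l.55655, (W2)) — at F4 the depth-`(n+1)` brick list of record
`fun m => …At (toSite (rs (n + 1 − m))) Lc` and the lower storey's `fun m => …At (toSite (rs (n − m + 1))) Lc` agree only for `m ≤ n + 1` (truncated subtraction), so the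
junction with `TorusCompositeInsertionKernelPacked ∕ pairing_of_kernel_succ` needs exactly these letters.  [folklore] inductions BY NAME; no def; nothing of Bałaban's
asserted; 0 estimates; 0∕4 row-D1 binders; NOT (C1), NOT D1, NOT BetaPertH, NOT continuum, NOT Clay.

HONEST DEPENDENCY (page 1, mandatory): continuum YM on T⁴ ⇐ BetaPertH ∧ nine spine estimates (0/9 proved); BetaPertH ⇐ (D1) ∧ (D4) ∧ CAP+tail;
G-an2-4 gates asym, D1 and NE2/3/4.  Row D1 ∕ (C1) OWNER an2, gen 50, 2026-08-23.  No existing file touched.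
-/

noncomputable section

namespace Summit.QuantumFields.BalabanUV.Beta.CompositeVertexKernelRec

open Finset
open Literature.MathematicalPhysics.QuantumFieldTheory.Balaban1983to89
open Literature.MathematicalPhysics.QuantumFieldTheory.Balaban1983to89.Beta
open AffineAveraging (Site)
open AveragingHessianKernels (Bond)

variable {d : ℕ}
variable {ℓ : ℕ → Fin (d + 1) → Site (d + 1) → Bond (d + 1) → ℝ}
  {𝓋 : ℕ → Fin (d + 1) → Site (d + 1) → Bond (d + 1) → Bond (d + 1) → ℝ} {L : ℕ}


/-- [folklore] `compLinKer … n` depends on the bricks `ℓ m`, `m < n`, only. -/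
theorem compLinKer_congr {ℓ' : ℕ → Fin (d + 1) → Site (d + 1) → Bond (d + 1) → ℝ} :
    ∀ (n : ℕ), (∀ m < n, ∀ μ y g, ℓ m μ y g = ℓ' m μ y g) → ∀ f g : Bond (d + 1), compLinKer ℓ L n f g = compLinKer ℓ' L n f g
  | 0, _, f, g => rfl
  | n + 1, h, f, g => by
      rw [compLinKer_succ, compLinKer_succ]
      refine Finset.sum_congr rfl fun κ _ => Finset.sum_congr rfl fun e _ => ?_
      rw [h n (Nat.lt_succ_self n), compLinKer_congr n (fun m hm => h m (Nat.lt_succ_of_lt hm))]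

/-- [folklore] `compVHKer … n` depends on the bricks `ℓ m`, `𝓋 m`, `m < n`, only. -/
theorem compVHKer_congr {ℓ' : ℕ → Fin (d + 1) → Site (d + 1) → Bond (d + 1) → ℝ}
    {𝓋' : ℕ → Fin (d + 1) → Site (d + 1) → Bond (d + 1) → Bond (d + 1) → ℝ} :
    ∀ (n : ℕ), (∀ m < n, ∀ μ y g, ℓ m μ y g = ℓ' m μ y g) → (∀ m < n, ∀ μ y g g', 𝓋 m μ y g g' = 𝓋' m μ y g g') →
      ∀ (μ : Fin (d + 1)) (y : Site (d + 1)) (f f' : Bond (d + 1)), compVHKer ℓ 𝓋 L n μ y f f' = compVHKer ℓ' 𝓋' L n μ y f f'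
  | 0, _, _, _, _, _, _ => rfl
  | n + 1, hℓ, h𝓋, μ, y, f, f' => by
      rw [compVHKer_succ, compVHKer_succ]
      have hc : ∀ b g : Bond (d + 1), compLinKer ℓ L n b g = compLinKer ℓ' L n b g :=
        fun b g => compLinKer_congr n (fun m hm => hℓ m (Nat.lt_succ_of_lt hm)) b g
      congr 1
      · refine Finset.sum_congr rfl fun κ _ => Finset.sum_congr rfl fun e _ =>
          Finset.sum_congr rfl fun κ' _ => Finset.sum_congr rfl fun e' _ => ?_
        rw [h𝓋 n (Nat.lt_succ_self n), hc, hc]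
      · refine Finset.sum_congr rfl fun κ _ => Finset.sum_congr rfl fun e _ => ?_
        rw [hℓ n (Nat.lt_succ_self n),
          compVHKer_congr n (fun m hm => hℓ m (Nat.lt_succ_of_lt hm)) (fun m hm => h𝓋 m (Nat.lt_succ_of_lt hm))]

/-- [folklore] `compVhS … n` depends on the bricks at levels `m < n` only. -/
theorem compVhS_congr {ℓ' : ℕ → Fin (d + 1) → Site (d + 1) → Bond (d + 1) → ℝ}
    {𝓋' : ℕ → Fin (d + 1) → Site (d + 1) → Bond (d + 1) → Bond (d + 1) → ℝ} (n : ℕ)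
    (hℓ : ∀ m < n, ∀ μ y g, ℓ m μ y g = ℓ' m μ y g) (h𝓋 : ∀ m < n, ∀ μ y g g', 𝓋 m μ y g g' = 𝓋' m μ y g g') :
    compVhS ℓ 𝓋 L n = compVhS ℓ' 𝓋' L n := by
  have e : compVHKer ℓ 𝓋 L n = compVHKer ℓ' 𝓋' L n := by
    funext μ y f f'; exact compVHKer_congr n hℓ h𝓋 μ y f f'
  unfold compVhS; rw [e]

end Summit.QuantumFields.BalabanUV.Beta.CompositeVertexKernelRec

end
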